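import Summits.KontsevichZagierPeriods.KontsevichZagierPeriods.Theorems.TerasomaMultiplicationBetaCancellationStubTameFormAux17

/-!
# `BetaCancellation` (stmt-KontsevichZagierPeriods-13633), line `divisor-slicing-transshipment` — stub `stub_tameForm`, auxiliary file 20: realising the normal form by two representations

**Realisation.** Given representations `RA p`, `RB q` (dimension `e + 1`, positive integrands,
domains inside `{y | y_last ∈ (0,2)}`) and an `MIso` between the families of catalytic cylinders
`K × (RA p).domain`, `K × (RB q).domain`, translate the tails apart along the last coordinate (rule
(2), `KZ.exists_translate`), glue (rule (1a)) to `A`, `B` with `[A] ≡ ∑ₚ [RA p]`, `[B] ≡ ∑_q [RB q]`;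
the conjugated pieces are literally the data of the conclusion of `stub_tameForm`.

References: crux NOTES c6 (F13); M. Kontsevich, D. Zagier, *Periods* (2001), §1.2.
-/

noncomputable section

-- `Summit.KontsevichZagierPeriods.KontsevichZagierPeriods.…` is the tree's mandated layout (single-conjunct summit).
set_option linter.dupNamespace false

namespace Summit.KontsevichZagierPeriods.KontsevichZagierPeriods.BetaCancellationDivisorSlicing

open MeasureTheory Set Function
open Literature.NumberTheory.Transcendental
open Literature.NumberTheory.Transcendental.KZ
open Literature.ModelTheory.ExponentialFields (IsSemialgebraic isSemialgebraic_univ)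

variable {e : ℕ}

/-! ### Gluing finitely many disjoint representations -/

/-- **Gluing a finite family of representations with pairwise disjoint domains**: the glued
representation has domain the union, integrand the given one on each piece, and
`[glue] − ∑ [Rᵢ] ∈ relations` (iterated rule (1a)). [cite: KontsevichZagier2001, §1.2 rule (1)] -/
theorem exists_glueFamily {N : ℕ} {ι : Type} [Fintype ι] (R : ι → IntegralRep N)
    (hdisj : ∀ i j, i ≠ j → Disjoint (R i).domain (R j).domain) :
    ∃ G : IntegralRep N, G.domain = ⋃ i, (R i).domain ∧
      (∀ i, EqOn G.integrand (R i).integrand (R i).domain) ∧ of G - ∑ i, of (R i) ∈ relations := by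
  classical
  -- the glued data
  let g : (Fin N → ℝ) → ℝ := fun x => ∑ i, (R i).domain.indicator (R i).integrand x
  have hg : ∀ i, EqOn g (R i).integrand (R i).domain := by
    intro i x hx
    simp only [g]
    rw [Finset.sum_eq_single i]
    · exact indicator_of_mem hx _
    · intro j _ hji
      exact indicator_of_notMem (fun hxj => (hdisj j i hji).le_bot ⟨hxj, hx⟩) _
    · exact fun h => (h (Finset.mem_univ i)).elim
  have hsa_aux : ∀ s : Finset ι, IsSemialgebraicFunOn ℚ (⋃ i ∈ s, (R i).domain) g := by
    intro s
    induction s using Finset.induction_on with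
    | empty =>
      simpa using (isSemialgebraicFunOn_aeval
        (Literature.ModelTheory.ExponentialFields.isSemialgebraic_empty (k := ℚ) (R := ℝ) (ι := Fin N)) 0).congr
        (fun _ h => h.elim)
    | insert a s ha ih =>
      have : (⋃ i ∈ insert a s, (R i).domain) = (R a).domain ∪ ⋃ i ∈ s, (R i).domain := by
        rw [Finset.set_biUnion_insert]
      rw [this]
      exact (R a).isSemialgebraicFunOn_integrand.union ih (hg a) (fun _ _ => rfl)
  have hsa : IsSemialgebraicFunOn ℚ (⋃ i, (R i).domain) g := by
    convert hsa_aux Finset.univ using 1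
    ext x; simp
  have hdom : IsSemialgebraic ℚ (⋃ i, (R i).domain) := by
    convert Literature.ModelTheory.ExponentialFields.IsSemialgebraic.biUnion Finset.univ _
      (fun i _ => (R i).isSemialgebraic_domain) using 1
    ext x; simp
  have hint : IntegrableOn g (⋃ i, (R i).domain) := by
    refine (integrable_finsetSum Finset.univ fun i _ => ?_).integrableOn
    exact (integrable_indicator_iff (IntegralRep.measurableSet_domain_holds (R i))).mpr (R i).integrableOn
  let G : IntegralRep N := ⟨_, g, hdom, hsa, hint⟩
  refine ⟨G, rfl, hg, ?_⟩
  refine of_sub_sum_of_mem_relations Finset.univ G R (fun i _ => ?_) (fun i _ => (hg i).symm.mono inter_subset_left)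
    ?_ (fun i _ j _ hij => ?_)
  · exact measure_mono_null (fun x hx => hx.2 (mem_iUnion.mpr ⟨i, hx.1⟩)) measure_empty
  · refine measure_mono_null (fun x hx => ?_) measure_empty
    obtain ⟨hx1, hx2⟩ := hx
    obtain ⟨i, hi⟩ := mem_iUnion.mp hx1
    exact hx2 (mem_iUnion₂.mpr ⟨i, Finset.mem_univ i, hi⟩)
  · show volume ((R i).domain ∩ (R j).domain) = 0
    rw [(hdisj i j hij).inter_eq, measure_empty]

/-! ### Translating tails apart -/

/-- Translates along the last coordinate by even integers `4p` of sets with last coordinate in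
`(0,2)` are pairwise disjoint. [folklore] -/
theorem disjoint_translates {T T' : Set (Fin (e + 1) → ℝ)} (hT : ∀ y ∈ T, y (Fin.last e) ∈ Ioo (0 : ℝ) 2)
    (hT' : ∀ y ∈ T', y (Fin.last e) ∈ Ioo (0 : ℝ) 2) {p p' : ℕ} (hpp : p ≠ p') :
    Disjoint ((fun y : Fin (e + 1) → ℝ => y - fun i => ((Pi.single (Fin.last e) (4 * (p : ℚ)) : Fin (e + 1) → ℚ) i : ℝ)) ⁻¹' T)
      ((fun y : Fin (e + 1) → ℝ => y - fun i => ((Pi.single (Fin.last e) (4 * (p' : ℚ)) : Fin (e + 1) → ℚ) i : ℝ)) ⁻¹' T') := by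
  rw [Set.disjoint_left]
  intro y hy hy'
  have h1 := hT _ hy
  have h2 := hT' _ hy'
  simp only [Pi.sub_apply, Pi.single_eq_same, Rat.cast_mul, Rat.cast_ofNat, Rat.cast_natCast, mem_Ioo] at h1 h2
  rcases lt_or_gt_of_ne hpp with h | h
  · have : (p : ℝ) + 1 ≤ p' := by exact_mod_cast h
    linarith
  · have : (p' : ℝ) + 1 ≤ p := by exact_mod_cast h
    linarith

/-! ### Realisation -/

/-- **Realisation of an `MIso` between families of catalytic cylinders by two representations**
(translate the tails apart along the last coordinate and glue). [folklore] -/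
theorem realize {ι κ : Type} [Fintype ι] [Fintype κ] (RA : ι → IntegralRep (e + 1))
    (RB : κ → IntegralRep (e + 1)) (hA : ∀ p, ∀ y ∈ (RA p).domain, 0 < (RA p).integrand y)
    (hB : ∀ q, ∀ y ∈ (RB q).domain, 0 < (RB q).integrand y)
    (hAl : ∀ p, ∀ y ∈ (RA p).domain, y (Fin.last e) ∈ Ioo (0 : ℝ) 2)
    (hBl : ∀ q, ∀ y ∈ (RB q).domain, y (Fin.last e) ∈ Ioo (0 : ℝ) 2)
    (mi : MIso (1 + (e + 1))
      (fun p => {w : Fin (1 + (e + 1)) → ℝ | (fun i : Fin (e + 1) => w (Fin.natAdd 1 i)) ∈ (RA p).domain})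
      (fun p w => 1 / (1 + w (Fin.castAdd (e + 1) 0) ^ 2) *
        (RA p).integrand (fun i : Fin (e + 1) => w (Fin.natAdd 1 i)))
      (fun q => {w : Fin (1 + (e + 1)) → ℝ | (fun i : Fin (e + 1) => w (Fin.natAdd 1 i)) ∈ (RB q).domain})
      (fun q w => 1 / (1 + w (Fin.castAdd (e + 1) 0) ^ 2) *
        (RB q).integrand (fun i : Fin (e + 1) => w (Fin.natAdd 1 i)))) :
    ∃ (A B : IntegralRep (e + 1)), (∀ a ∈ A.domain, 0 < A.integrand a) ∧ (∀ b ∈ B.domain, 0 < B.integrand b) ∧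
      of A - ∑ p, of (RA p) ∈ relations ∧ of B - ∑ q, of (RB q) ∈ relations ∧
      ∃ (J : ℕ) (S : Fin J → Set (Fin (1 + (e + 1)) → ℝ))
        (Ψ : Fin J → (Fin (1 + (e + 1)) → ℝ) → (Fin (1 + (e + 1)) → ℝ))
        (Ψ' : Fin J → (Fin (1 + (e + 1)) → ℝ) → ((Fin (1 + (e + 1)) → ℝ) →L[ℝ] (Fin (1 + (e + 1)) → ℝ))),
        (∀ j, IsSemialgebraic ℚ (S j) ∧ S j ⊆ {z | (fun i => z (Fin.natAdd 1 i)) ∈ A.domain} ∧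
          IsSemialgebraicMapOn ℚ (S j) (Ψ j) ∧ Set.InjOn (Ψ j) (S j) ∧
          (∀ z ∈ S j, HasFDerivWithinAt (Ψ j) (Ψ' j z) (S j) z) ∧
          Ψ j '' S j ⊆ {z | (fun i => z (Fin.natAdd 1 i)) ∈ B.domain} ∧
          ∀ z ∈ S j, 1 / (1 + z (Fin.castAdd (e + 1) 0) ^ 2) * A.integrand (fun i => z (Fin.natAdd 1 i)) =
            1 / (1 + (Ψ j z) (Fin.castAdd (e + 1) 0) ^ 2) * B.integrand (fun i => (Ψ j z) (Fin.natAdd 1 i)) *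
              |(Ψ' j z).det|) ∧
        (∀ j j', j ≠ j' → volume (S j ∩ S j') = 0 ∧ volume (Ψ j '' S j ∩ Ψ j' '' S j') = 0) ∧
        volume ({z : Fin (1 + (e + 1)) → ℝ | (fun i => z (Fin.natAdd 1 i)) ∈ A.domain} \ ⋃ j, S j) = 0 ∧
        volume ({z : Fin (1 + (e + 1)) → ℝ | (fun i => z (Fin.natAdd 1 i)) ∈ B.domain} \ ⋃ j, Ψ j '' S j) = 0 := by
  classical
  -- translation vectors
  let eA := Fintype.equivFin ι
  let eB := Fintype.equivFin κ
  let vA : ι → Fin (e + 1) → ℚ := fun p => Pi.single (Fin.last e) (4 * ((eA p : ℕ) : ℚ))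
  let vB : κ → Fin (e + 1) → ℚ := fun q => Pi.single (Fin.last e) (4 * ((eB q : ℕ) : ℚ))
  let wA : ι → Fin (e + 1) → ℝ := fun p i => (vA p i : ℝ)
  let wB : κ → Fin (e + 1) → ℝ := fun q i => (vB q i : ℝ)
  -- translated tails
  have hRA' : ∀ p, ∃ R' : IntegralRep (e + 1), R'.domain = (fun y => y - wA p) ⁻¹' (RA p).domain ∧
      (R'.integrand = fun y => (RA p).integrand (y - wA p)) ∧ of (RA p) - of R' ∈ changeOfVariablesRel :=
    fun p => exists_translate (RA p) (vA p)
  have hRB' : ∀ q, ∃ R' : IntegralRep (e + 1), R'.domain = (fun y => y - wB q) ⁻¹' (RB q).domain ∧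
      (R'.integrand = fun y => (RB q).integrand (y - wB q)) ∧ of (RB q) - of R' ∈ changeOfVariablesRel :=
    fun q => exists_translate (RB q) (vB q)
  choose RA' hRA'd hRA'i hRA'r using hRA'
  choose RB' hRB'd hRB'i hRB'r using hRB'
  have hdisjA : ∀ p p', p ≠ p' → Disjoint (RA' p).domain (RA' p').domain := by
    intro p p' hpp
    rw [hRA'd, hRA'd]
    exact disjoint_translates (hAl p) (hAl p') (fun h => hpp (eA.injective (Fin.ext h)))
  have hdisjB : ∀ q q', q ≠ q' → Disjoint (RB' q).domain (RB' q').domain := by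
    intro q q' hqq
    rw [hRB'd, hRB'd]
    exact disjoint_translates (hBl q) (hBl q') (fun h => hqq (eB.injective (Fin.ext h)))
  obtain ⟨A, hAd, hAi, hAr⟩ := exists_glueFamily RA' hdisjA
  obtain ⟨B, hBd, hBi, hBr⟩ := exists_glueFamily RB' hdisjB
  refine ⟨A, B, fun a ha => ?_, fun b hb => ?_, ?_, ?_, ?_⟩
  · rw [hAd] at ha
    obtain ⟨p, hp⟩ := mem_iUnion.mp ha
    rw [hAi p hp, hRA'i]
    exact hA p _ (by simpa [hRA'd] using hp)
  · rw [hBd] at hb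
    obtain ⟨q, hq⟩ := mem_iUnion.mp hb
    rw [hBi q hq, hRB'i]
    exact hB q _ (by simpa [hRB'd] using hq)
  · have h2 : ∑ p, of (RA' p) - ∑ p, of (RA p) ∈ relations :=
      sum_sub_sum_mem_relations Finset.univ _ _ fun p _ => by
        simpa using relations.neg_mem (changeOfVariablesRel_subset_relations (hRA'r p))
    have : of A - ∑ p, of (RA p) = (of A - ∑ p, of (RA' p)) + (∑ p, of (RA' p) - ∑ p, of (RA p)) := by abel
    rw [this]
    exact relations.add_mem hAr h2
  · have h2 : ∑ q, of (RB' q) - ∑ q, of (RB q) ∈ relations :=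
      sum_sub_sum_mem_relations Finset.univ _ _ fun q _ => by
        simpa using relations.neg_mem (changeOfVariablesRel_subset_relations (hRB'r q))
    have : of B - ∑ q, of (RB q) = (of B - ∑ q, of (RB' q)) + (∑ q, of (RB' q) - ∑ q, of (RB q)) := by abel
    rw [this]
    exact relations.add_mem hBr h2
  -- the pieces, conjugated by the translations
  let VA : ι → Fin (1 + (e + 1)) → ℝ := fun p => Fin.append (0 : Fin 1 → ℝ) (wA p)
  let VB : κ → Fin (1 + (e + 1)) → ℝ := fun q => Fin.append (0 : Fin 1 → ℝ) (wB q)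
  have hVA0 : ∀ p, VA p (Fin.castAdd (e + 1) 0) = 0 := fun p => by simp [VA]
  have hVB0 : ∀ q, VB q (Fin.castAdd (e + 1) 0) = 0 := fun q => by simp [VB]
  have hVAt : ∀ p (w : Fin (1 + (e + 1)) → ℝ), (fun i : Fin (e + 1) => (w - VA p) (Fin.natAdd 1 i)) =
      (fun i : Fin (e + 1) => w (Fin.natAdd 1 i)) - wA p := fun p w => by
    funext i; simp [VA]
  have hVBt : ∀ q (w : Fin (1 + (e + 1)) → ℝ), (fun i : Fin (e + 1) => (w + VB q) (Fin.natAdd 1 i)) =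
      (fun i : Fin (e + 1) => w (Fin.natAdd 1 i)) + wB q := fun q w => by
    funext i; simp [VB]
  have hVBt' : ∀ q (w : Fin (1 + (e + 1)) → ℝ), (fun i : Fin (e + 1) => (w - VB q) (Fin.natAdd 1 i)) =
      (fun i : Fin (e + 1) => w (Fin.natAdd 1 i)) - wB q := fun q w => by
    funext i; simp [VB]
  -- translations are `ℚ`-polynomial maps
  have hVAq : ∀ p, ∃ c : Fin (1 + (e + 1)) → ℚ, VA p = fun i => (c i : ℝ) := fun p =>
    ⟨Fin.append (0 : Fin 1 → ℚ) (vA p), by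
      funext i; refine Fin.addCases (fun i => ?_) (fun i => ?_) i <;> simp [VA, wA]⟩
  have hVBq : ∀ q, ∃ c : Fin (1 + (e + 1)) → ℚ, VB q = fun i => (c i : ℝ) := fun q =>
    ⟨Fin.append (0 : Fin 1 → ℚ) (vB q), by
      funext i; refine Fin.addCases (fun i => ?_) (fun i => ?_) i <;> simp [VB, wB]⟩
  have hsub_sa : ∀ (c : Fin (1 + (e + 1)) → ℚ) {T : Set (Fin (1 + (e + 1)) → ℝ)}, IsSemialgebraic ℚ T →
      IsSemialgebraicMapOn ℚ T (fun w => w - fun i => (c i : ℝ)) ∧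
      IsSemialgebraicMapOn ℚ T (fun w => w + fun i => (c i : ℝ)) ∧
      ∀ {P : Set (Fin (1 + (e + 1)) → ℝ)}, IsSemialgebraic ℚ P →
        IsSemialgebraic ℚ ((fun w => w - fun i => (c i : ℝ)) ⁻¹' P) := by
    intro c T hT
    have hpoly : ∀ x : Fin (1 + (e + 1)) → ℝ, (fun j => MvPolynomial.aeval x
        (MvPolynomial.X j - MvPolynomial.C (c j) : MvPolynomial (Fin (1 + (e + 1))) ℚ)) =
        x - fun i => (c i : ℝ) := fun x => by ext j; simp
    have hpoly' : ∀ x : Fin (1 + (e + 1)) → ℝ, (fun j => MvPolynomial.aeval x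
        (MvPolynomial.X j + MvPolynomial.C (c j) : MvPolynomial (Fin (1 + (e + 1))) ℚ)) =
        x + fun i => (c i : ℝ) := fun x => by ext j; simp
    refine ⟨(isSemialgebraicMapOn_aeval hT _).congr fun x _ => hpoly x,
      (isSemialgebraicMapOn_aeval hT _).congr fun x _ => hpoly' x, fun hP => ?_⟩
    have := hP.preimage_aeval (fun j : Fin (1 + (e + 1)) =>
      (MvPolynomial.X j - MvPolynomial.C (c j) : MvPolynomial (Fin (1 + (e + 1))) ℚ))
    have heq : (fun (x : Fin (1 + (e + 1)) → ℝ) (j : Fin (1 + (e + 1))) => MvPolynomial.aeval x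
        (MvPolynomial.X j - MvPolynomial.C (c j) : MvPolynomial (Fin (1 + (e + 1))) ℚ)) =
        fun x => x - fun i => (c i : ℝ) := funext hpoly
    rwa [heq] at this
  let Sj : Fin mi.J → Set (Fin (1 + (e + 1)) → ℝ) := fun j => (fun w => w - VA (mi.src j)) ⁻¹' mi.P j
  let Ψj : Fin mi.J → (Fin (1 + (e + 1)) → ℝ) → (Fin (1 + (e + 1)) → ℝ) := fun j w =>
    mi.Ψ j (w - VA (mi.src j)) + VB (mi.tgt j)
  let Ψj' : Fin mi.J → (Fin (1 + (e + 1)) → ℝ) → ((Fin (1 + (e + 1)) → ℝ) →L[ℝ] (Fin (1 + (e + 1)) → ℝ)) :=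
    fun j w => mi.Ψ' j (w - VA (mi.src j))
  have himg : ∀ j, Ψj j '' Sj j = (fun y => y - VB (mi.tgt j)) ⁻¹' (mi.Ψ j '' mi.P j) := by
    intro j
    ext y
    simp only [Sj, Ψj, mem_image, mem_preimage]
    constructor
    · rintro ⟨w, hw, rfl⟩
      exact ⟨w - VA (mi.src j), hw, by simp⟩
    · rintro ⟨z, hz, hzy⟩
      exact ⟨z + VA (mi.src j), by simpa using hz, by rw [add_sub_cancel_right, hzy, sub_add_cancel]⟩
  refine ⟨mi.J, Sj, Ψj, Ψj', fun j => ?_, fun j j' hjj => ⟨?_, ?_⟩, ?_, ?_⟩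
  · obtain ⟨h1, h2, h3, h4, h5, h6, h7⟩ := mi.piece j
    obtain ⟨cA, hcA⟩ := hVAq (mi.src j)
    obtain ⟨cB, hcB⟩ := hVBq (mi.tgt j)
    have hS : IsSemialgebraic ℚ (Sj j) := by
      have := (hsub_sa cA h1).2.2 h1
      simpa only [Sj, hcA] using this
    have hmaps : MapsTo (fun w => w - VA (mi.src j)) (Sj j) (mi.P j) := fun w hw => hw
    refine ⟨hS, fun w hw => ?_, ?_, ?_, fun w hw => ?_, ?_, fun w hw => ?_⟩
    · -- inside the cylinder over `A.domain`
      have hz := h2 hw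
      simp only [mem_setOf_eq] at hz ⊢
      rw [hVAt] at hz
      rw [hAd]
      exact mem_iUnion.mpr ⟨mi.src j, by rw [hRA'd]; exact hz⟩
    · -- semialgebraic map
      have hin : IsSemialgebraicMapOn ℚ (Sj j) (fun w => w - VA (mi.src j)) := by
        have := (hsub_sa cA hS).1; simpa only [hcA] using this
      have hmid : IsSemialgebraicMapOn ℚ (Sj j) (mi.Ψ j ∘ fun w => w - VA (mi.src j)) :=
        IsSemialgebraicMapOn.comp_holds h3 hin hmaps
      have hout : IsSemialgebraicMapOn ℚ (Set.univ : Set (Fin (1 + (e + 1)) → ℝ)) (fun y => y + VB (mi.tgt j)) := by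
        have := (hsub_sa cB isSemialgebraic_univ).2.1; simpa only [hcB] using this
      exact IsSemialgebraicMapOn.comp_holds hout hmid (mapsTo_univ _ _)
    · -- injective
      intro w hw w' hw' h
      have : mi.Ψ j (w - VA (mi.src j)) = mi.Ψ j (w' - VA (mi.src j)) := add_right_cancel h
      have := h4 hw hw' this
      exact sub_left_injective this
    · -- derivative
      have hτ : HasFDerivWithinAt (fun w : Fin (1 + (e + 1)) → ℝ => w - VA (mi.src j))
          (ContinuousLinearMap.id ℝ _) (Sj j) w := ((hasFDerivAt_id w).sub_const _).hasFDerivWithinAt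
      have hc := (h5 _ (hmaps hw)).comp w hτ hmaps
      rw [ContinuousLinearMap.comp_id] at hc
      exact hc.add_const _
    · -- image inside the cylinder over `B.domain`
      rintro _ ⟨w, hw, rfl⟩
      have hz := h6 ⟨_, hmaps hw, rfl⟩
      simp only [mem_setOf_eq] at hz ⊢
      rw [show (fun i : Fin (e + 1) => Ψj j w (Fin.natAdd 1 i)) =
        (fun i : Fin (e + 1) => (mi.Ψ j (w - VA (mi.src j))) (Fin.natAdd 1 i)) + wB (mi.tgt j) from hVBt _ _, hBd]
      refine mem_iUnion.mpr ⟨mi.tgt j, ?_⟩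
      rw [hRB'd]
      simpa using hz
    · -- measure preservation
      have hz := hmaps hw
      have hzt : (fun i : Fin (e + 1) => (w - VA (mi.src j)) (Fin.natAdd 1 i)) ∈ (RA (mi.src j)).domain := h2 hz
      have hAt : A.integrand (fun i => w (Fin.natAdd 1 i)) = (RA (mi.src j)).integrand
          (fun i : Fin (e + 1) => (w - VA (mi.src j)) (Fin.natAdd 1 i)) := by
        have hmem : (fun i : Fin (e + 1) => w (Fin.natAdd 1 i)) ∈ (RA' (mi.src j)).domain := by
          rw [hRA'd]; rw [hVAt] at hzt; exact hzt
        rw [hAi _ hmem, hRA'i, hVAt]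
      have himgz := h6 ⟨_, hz, rfl⟩
      have hBt : B.integrand (fun i => Ψj j w (Fin.natAdd 1 i)) = (RB (mi.tgt j)).integrand
          (fun i : Fin (e + 1) => mi.Ψ j (w - VA (mi.src j)) (Fin.natAdd 1 i)) := by
        have heq : (fun i : Fin (e + 1) => Ψj j w (Fin.natAdd 1 i)) =
            (fun i : Fin (e + 1) => (mi.Ψ j (w - VA (mi.src j))) (Fin.natAdd 1 i)) + wB (mi.tgt j) := hVBt _ _
        have hmem : (fun i : Fin (e + 1) => Ψj j w (Fin.natAdd 1 i)) ∈ (RB' (mi.tgt j)).domain := by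
          rw [hRB'd, mem_preimage, heq, add_sub_cancel_right]
          exact himgz
        rw [hBi _ hmem, hRB'i, heq]
        simp only [add_sub_cancel_right]
      have h0 : w (Fin.castAdd (e + 1) 0) = (w - VA (mi.src j)) (Fin.castAdd (e + 1) 0) := by
        simp [hVA0]
      have h0' : Ψj j w (Fin.castAdd (e + 1) 0) = mi.Ψ j (w - VA (mi.src j)) (Fin.castAdd (e + 1) 0) := by
        simp [Ψj, hVB0]
      rw [hAt, hBt, h0, h0']
      exact h7 _ hz
  · -- a.e. disjoint pieces
    by_cases hs : mi.src j = mi.src j'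
    · have : Sj j ∩ Sj j' = (fun w => w + -VA (mi.src j)) ⁻¹' (mi.P j ∩ mi.P j') := by
        ext w; simp [Sj, hs, sub_eq_add_neg]
      rw [this, measure_preimage_add_right]
      exact mi.disjoint_src j j' hjj hs
    · refine measure_mono_null (fun w hw => ?_) measure_empty
      have h1 : (fun i : Fin (e + 1) => w (Fin.natAdd 1 i)) ∈ (RA' (mi.src j)).domain := by
        have := (mi.piece j).2.1 hw.1
        simp only [mem_setOf_eq] at this
        rw [hVAt] at this
        rw [hRA'd]; exact this
      have h2 : (fun i : Fin (e + 1) => w (Fin.natAdd 1 i)) ∈ (RA' (mi.src j')).domain := by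
        have := (mi.piece j').2.1 hw.2
        simp only [mem_setOf_eq] at this
        rw [hVAt] at this
        rw [hRA'd]; exact this
      exact (hdisjA _ _ hs).le_bot ⟨h1, h2⟩
  · -- a.e. disjoint images
    rw [himg, himg]
    by_cases ht : mi.tgt j = mi.tgt j'
    · have : (fun y => y - VB (mi.tgt j)) ⁻¹' (mi.Ψ j '' mi.P j) ∩ (fun y => y - VB (mi.tgt j')) ⁻¹' (mi.Ψ j' '' mi.P j') =
          (fun w => w + -VB (mi.tgt j)) ⁻¹' (mi.Ψ j '' mi.P j ∩ mi.Ψ j' '' mi.P j') := by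
        ext w; simp [ht, sub_eq_add_neg]
      rw [this, measure_preimage_add_right]
      exact mi.disjoint_tgt j j' hjj ht
    · refine measure_mono_null (fun y hy => ?_) measure_empty
      have key : ∀ (j₀ : Fin mi.J), y ∈ (fun y => y - VB (mi.tgt j₀)) ⁻¹' (mi.Ψ j₀ '' mi.P j₀) →
          (fun i : Fin (e + 1) => y (Fin.natAdd 1 i)) ∈ (RB' (mi.tgt j₀)).domain := by
        intro j₀ hy₀
        have := (mi.piece j₀).2.2.2.2.2.1 hy₀
        simp only [mem_setOf_eq] at this
        rw [hVBt'] at this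
        rw [hRB'd]; exact this
      exact (hdisjB _ _ ht).le_bot ⟨key j hy.1, key j' hy.2⟩
  · -- a.e. covering of the source cylinder
    have hsub : {z : Fin (1 + (e + 1)) → ℝ | (fun i => z (Fin.natAdd 1 i)) ∈ A.domain} \ (⋃ j, Sj j) ⊆
        ⋃ p, (fun w => w + -VA p) ⁻¹'
          ({w : Fin (1 + (e + 1)) → ℝ | (fun i : Fin (e + 1) => w (Fin.natAdd 1 i)) ∈ (RA p).domain} \
            ⋃ (j) (_ : mi.src j = p), mi.P j) := by
      intro w hw
      obtain ⟨hw1, hw2⟩ := hw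
      simp only [mem_setOf_eq, hAd] at hw1
      obtain ⟨p, hp⟩ := mem_iUnion.mp hw1
      refine mem_iUnion.mpr ⟨p, ?_⟩
      simp only [mem_preimage, Set.mem_sdiff, mem_setOf_eq, mem_iUnion, not_exists]
      refine ⟨?_, fun j hj hz => hw2 (mem_iUnion.mpr ⟨j, ?_⟩)⟩
      · have : (fun i : Fin (e + 1) => (w + -VA p) (Fin.natAdd 1 i)) =
            (fun i : Fin (e + 1) => w (Fin.natAdd 1 i)) - wA p := by
          rw [← sub_eq_add_neg]; exact hVAt p w
        rw [this]
        rw [hRA'd] at hp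
        exact hp
      · show w - VA (mi.src j) ∈ mi.P j
        rw [hj, sub_eq_add_neg]
        exact hz
    refine measure_mono_null hsub (measure_iUnion_null_iff.mpr fun p => ?_)
    rw [measure_preimage_add_right]
    exact mi.cover_src p
  · -- a.e. covering of the target cylinder
    have hsub : {z : Fin (1 + (e + 1)) → ℝ | (fun i => z (Fin.natAdd 1 i)) ∈ B.domain} \ (⋃ j, Ψj j '' Sj j) ⊆
        ⋃ q, (fun w => w + -VB q) ⁻¹'
          ({w : Fin (1 + (e + 1)) → ℝ | (fun i : Fin (e + 1) => w (Fin.natAdd 1 i)) ∈ (RB q).domain} \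
            ⋃ (j) (_ : mi.tgt j = q), mi.Ψ j '' mi.P j) := by
      intro y hy
      obtain ⟨hy1, hy2⟩ := hy
      simp only [mem_setOf_eq, hBd] at hy1
      obtain ⟨q, hq⟩ := mem_iUnion.mp hy1
      refine mem_iUnion.mpr ⟨q, ?_⟩
      simp only [mem_preimage, Set.mem_sdiff, mem_setOf_eq, mem_iUnion, not_exists]
      refine ⟨?_, fun j hj hz => hy2 (mem_iUnion.mpr ⟨j, ?_⟩)⟩
      · have : (fun i : Fin (e + 1) => (y + -VB q) (Fin.natAdd 1 i)) =
            (fun i : Fin (e + 1) => y (Fin.natAdd 1 i)) - wB q := by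
          rw [← sub_eq_add_neg]; exact hVBt' q y
        rw [this]
        rw [hRB'd] at hq
        exact hq
      · rw [himg]
        show y - VB (mi.tgt j) ∈ mi.Ψ j '' mi.P j
        rw [hj, sub_eq_add_neg]
        exact hz
    refine measure_mono_null hsub (measure_iUnion_null_iff.mpr fun q => ?_)
    rw [measure_preimage_add_right]
    exact mi.cover_tgt q

/-! ### Headline -/

/-- Registered helper goal of the stub `stub_tameForm`: gluing a finite family of representations
with pairwise disjoint domains. [cite: KontsevichZagier2001, §1.2 rule (1)] -/
theorem tameForm_aux_glueFamily : ∀ {N : ℕ} {ι : Type} [Fintype ι] (R : ι → IntegralRep N), (∀ i j, i ≠ j → Disjoint (R i).domain (R j).domain) → ∃ G : IntegralRep N, G.domain = ⋃ i, (R i).domain ∧ (∀ i, Set.EqOn G.integrand (R i).integrand (R i).domain) ∧ of G - ∑ i, of (R i) ∈ relations :=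
  fun R hdisj => exists_glueFamily R hdisj

end Summit.KontsevichZagierPeriods.KontsevichZagierPeriods.BetaCancellationDivisorSlicing

end
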